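import Literature.AlgebraicGeometry.ModuliOfAbelianVarieties.SiegelCanonicalModel
import Literature.AlgebraicGeometry.Motives.PointsDeterminedAction
import Literature.AlgebraicGeometry.Motives.BaseChangeHomDescent
import Literature.AlgebraicGeometry.Motives.VarietiesGeometricallyIntegralProofs
import Literature.AlgebraicGeometry.HodgeTheory.HodgeGenericQbarDescentFiniteMonodromyInputs
import HarnessLib

/-!
# The integral Hecke operators of a Siegel rational model form an ACTION of `GSp_δ(ℤ̂)` by `ℚ`-automorphisms
# ([Deligne1971TravauxShimura] Déf. 3.1 «modèle … muni de l'action de G(𝔸_f)»; [Milne2005ShimuraVarieties] Thm. 13.6)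

Topic `AlgebraicGeometry/ModuliOfAbelianVarieties`; namespace `Literature.AlgebraicGeometry.ModuliOfAbelianVarieties`. The tree's
(σ4)-D interface `SiegelRationalModel.HasIntegralHecke` only posits, for each `γ ∈ K_δ(1) = GSp_δ(ℤ̂)` and each principal level `K`,
SOME `ℚ`-endomorphism `Tq` of the model `R.Nm K` acting on the `ℚ`-structure points by the right translate `[J, a] ↦ [J, aγ]`.
Since `R.Nm K` is quasi-projective (separated, of finite type) over `ℚ` and its complex fibre `Sg.Mc K` is smooth (reduced), a
`ℚ`-endomorphism is DETERMINED by its effect on complex points (the tree's `Motives.exists_monoidHom_aut_of_forall_pts`,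
`Motives/PointsDeterminedAction`); hence the `Tq` assemble to a homomorphism `GSp_δ(ℤ̂) →* Aut_ℚ(R.Nm K)` — as a LEFT action,
`γ ↦ T_{γ⁻¹}` — with the point formula `[J, a] ↦ [J, a γ⁻¹]` (`SiegelRationalModel.exists_heckeAction`). This is step D2 of the I-1′
receptacle plan (cell `hodgecm-mathlib`, crux `HDel`, `stub_Squot`): the finite Hecke group acting on the Siegel `ℚ`-model whose
quotient is the receptacle. Everything is proved; no definitions, no named facts.

## References
* [Deligne1971TravauxShimura] P. Deligne, *Travaux de Shimura* (1971), Déf. 3.1 p. 136; 4.16–4.17, Thm. 4.21 p. 152.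
* [Milne2005ShimuraVarieties] J. S. Milne, *Introduction to Shimura Varieties* (2005), Thm. 13.6 p. 118; §13 p. 117.
-/

noncomputable section

open CategoryTheory CategoryTheory.Limits AlgebraicGeometry
open Literature.AlgebraicGeometry.Motives Literature.AlgebraicGeometry.HodgeTheory

universe u

namespace Literature.AlgebraicGeometry.ModuliOfAbelianVarieties

namespace SiegelRationalModel

variable {g : ℕ} {δ : Fin g → ℕ} {Sg : SiegelComplexRecordSystem g δ} (R : SiegelRationalModel g δ Sg)

set_option backward.isDefEq.respectTransparency false

/-- Every `ℚ`-structure point of `R.Nm K` is `R.ptQ K` of a double coset `[J, aK]` (`ptQ` is a bijection followed by the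
bijection `Sg.pts`; `SiegelShimuraSet.mk` is onto). [cite: Milne2005ShimuraVarieties, §13 p. 117] -/
theorem exists_eq_ptQ_mk (K : SiegelLevel δ) (P : ComplexPoints (R.Nm.obj K)) :
    ∃ (J : C0pm δ) (a : gspFinAdelic δ), P = R.ptQ K ((Sg.pts K).symm (SiegelShimuraSet.mk δ K.1 J a)) := by
  -- invert `ptQ = bce.symm ∘ AlgPoints.map e⁻¹`
  set Q : ComplexPoints (Sg.Mc.obj K) :=
    AlgPoints.map (R.e.hom.app K) (AlgPoints.baseChangeEquiv (algebraMap ℚ ℂ) (R.Nm.obj K) P) with hQ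
  obtain ⟨⟨J, a⟩, hJa⟩ := SiegelShimuraSet.mk_surjective (δ := δ) (K := K.1) ((Sg.pts K) Q)
  refine ⟨J, a, ?_⟩
  have hJa' : SiegelShimuraSet.mk δ K.1 J a = (Sg.pts K) Q := hJa
  rw [hJa', Equiv.symm_apply_apply, ptQ_def, hQ, ← AlgPoints.map_comp_apply]
  have : R.e.hom.app K ≫ R.e.inv.app K = 𝟙 _ := by
    rw [← NatTrans.comp_app, Iso.hom_inv_id, NatTrans.id_app]
  rw [this, AlgPoints.map_id_apply, Equiv.symm_apply_apply]

/-- **The integral Hecke operators form a left action by `ℚ`-automorphisms** of the Siegel `ℚ`-model at every principal level: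
from `R.HasIntegralHecke` there is `act : GSp_δ(ℤ̂) →* Aut_ℚ(R.Nm K)` with `act γ` acting on the `ℚ`-structure points by
`[J, a] ↦ [J, a γ⁻¹]` (a `ℚ`-endomorphism of the quasi-projective model with smooth complex fibre is determined by its complex
points: `Motives.exists_monoidHom_aut_of_forall_pts`). [cite: Deligne1971TravauxShimura, Déf. 3.1 p. 136]
[cite: Milne2005ShimuraVarieties, Thm. 13.6 p. 118] -/
theorem exists_heckeAction (hR : R.HasIntegralHecke) (K : SiegelLevel δ) :
    ∃ act : ↥(principalLevelSubgroup δ 1) →* Aut (R.Nm.obj K),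
      ∀ (γ : ↥(principalLevelSubgroup δ 1)) (J : C0pm δ) (a : gspFinAdelic δ),
        AlgPoints.map (act γ).hom (R.ptQ K ((Sg.pts K).symm (SiegelShimuraSet.mk δ K.1 J a))) =
          R.ptQ K ((Sg.pts K).symm (SiegelShimuraSet.mk δ K.1 J (a * ((γ⁻¹ : ↥(principalLevelSubgroup δ 1)) : gspFinAdelic δ)))) := by
  classical
  -- the chosen endomorphisms `T γ := Tq(γ⁻¹)` and their point formula
  let T : ↥(principalLevelSubgroup δ 1) → (R.Nm.obj K ⟶ R.Nm.obj K) := fun γ =>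
    Classical.choose (hR K ((γ⁻¹ : ↥(principalLevelSubgroup δ 1)) : gspFinAdelic δ) (γ⁻¹).2)
  have hT : ∀ (γ : ↥(principalLevelSubgroup δ 1)) (J : C0pm δ) (a : gspFinAdelic δ),
      AlgPoints.map (T γ) (R.ptQ K ((Sg.pts K).symm (SiegelShimuraSet.mk δ K.1 J a))) =
        R.ptQ K ((Sg.pts K).symm (SiegelShimuraSet.mk δ K.1 J (a * ((γ⁻¹ : ↥(principalLevelSubgroup δ 1)) : gspFinAdelic δ)))) :=
    fun γ => Classical.choose_spec (hR K ((γ⁻¹ : ↥(principalLevelSubgroup δ 1)) : gspFinAdelic δ) (γ⁻¹).2)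
  -- the instances making complex points faithful on `ℚ`-endomorphisms
  haveI : IsSeparated (R.Nm.obj K).hom := isSeparated_hom_of_isQuasiProjectiveOver (R.quasiProjective K)
  haveI : LocallyOfFiniteType (R.Nm.obj K).hom := locallyOfFiniteType_hom_of_isQuasiProjectiveOver (R.quasiProjective K)
  haveI : Smooth (Sg.Mc.obj K).hom := Sg.smooth K
  haveI : IsReduced (Sg.Mc.obj K).left := isReduced_of_smooth_over_field (Sg.Mc.obj K).hom
  haveI : IsReduced ((Motives.baseChangeHom (algebraMap ℚ ℂ)).obj (R.Nm.obj K)).left :=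
    isReduced_of_isOpenImmersion (R.e.hom.app K).left
  haveI : IsReduced (R.Nm.obj K).left := isReduced_of_baseChangeHom (algebraMap ℚ ℂ) (R.Nm.obj K)
  have h1 : ∀ P : ComplexPoints (R.Nm.obj K), AlgPoints.map (T 1) P = P := by
    intro P
    obtain ⟨J, a, rfl⟩ := R.exists_eq_ptQ_mk K P
    rw [hT, inv_one, OneMemClass.coe_one, mul_one]
  have hmul : ∀ (γ γ' : ↥(principalLevelSubgroup δ 1)) (P : ComplexPoints (R.Nm.obj K)),
      AlgPoints.map (T (γ * γ')) P = AlgPoints.map (T γ) (AlgPoints.map (T γ') P) := by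
    intro γ γ' P
    obtain ⟨J, a, rfl⟩ := R.exists_eq_ptQ_mk K P
    rw [hT, hT, hT, mul_inv_rev, Subgroup.coe_mul, mul_assoc]
  obtain ⟨act, hact⟩ := exists_monoidHom_aut_of_forall_pts T h1 hmul
  exact ⟨act, fun γ J a => by rw [hact]; exact hT γ J a⟩

end SiegelRationalModel

end Literature.AlgebraicGeometry.ModuliOfAbelianVarieties

end
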